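import Summits.AtomisticToContinuum.Crystallization.Theorems.ChessboardParticlePlanesPeriodicWindowsGoodLimit
import Summits.AtomisticToContinuum.Crystallization.Theorems.LaminarSixThreeThreeLaminarKissingCap

/-!
# Crux `StackingFaultSparsity` (stmt-AtomisticToContinuum-14296), line `Sketch` — stub `stub_localFrameLimit`, A

Per-window bookkeeping for the compactness step S0 (`stub_localFrameLimit`): local frames of a
limit configuration, in the spirit of `PeriodicWindowsSketch.stub_goodLimit` (files
`ChessboardParticlePlanesPeriodicWindowsGoodLimit{,A,B,C}`), but with ONE frame per particle.

* `lf_gap_iter`, `lf_abs_label`, `lf_label_bound`, `lf_label_le_two`, `lf_label_le_one`,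
  `lf_level_strictMono` — level heights `C : ℤ → ℝ` with `C 0 = 0` and consecutive gaps `≥ 19/25`
  satisfy `|C t| ≥ 19/25 · |t|`, so a level of small height has a small index;
* `lf_clamp_gap` — clamping a gapped level function `f` to the boxes `[t - 3, t + 3]` keeps the
  gaps (this makes the level data range in a compact set);
* `lf_dist_transfer`, `lf_inner_transfer` — distances and heights of `δ`-approximants;
* `lf_normalise` — a GOOD(2, 1, η) window about a particle `jc` (its own lengths `a, b`, unit
  normal `n`, levels `c`, labels `l`) is re-labelled so that `jc` has label `0` and level height
  `0`, the levels are clamped to `[t - 3, t + 3]`, and all clauses hold with tolerance `δ ≥ 2η`.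
-/

noncomputable section

namespace Summit.AtomisticToContinuum.Crystallization.Theorems.SquareWellLayerCake.StackingFaultSparsity.LocalFrames.Limit

open Filter Metric Topology

/-! ## Levels with gaps -/

/-- Level heights with consecutive gaps `≥ 19/25` grow by at least `19/25` per level. -/
theorem lf_gap_iter {C : ℤ → ℝ} (hC : ∀ t : ℤ, C t + 19 / 25 ≤ C (t + 1)) {s t : ℤ} (h : s ≤ t) :
    C s + 19 / 25 * ((t : ℝ) - s) ≤ C t := by
  have hmono : Monotone fun m : ℤ => C m - 19 / 25 * (m : ℝ) :=
    monotone_int_of_le_succ fun m => by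
      have := hC m
      simp only [Int.cast_add, Int.cast_one]
      linarith
  have := hmono h
  simp only at this
  linarith

/-- With `C 0 = 0`, the height of level `t` is at least `19/25 · |t|` in absolute value. -/
theorem lf_abs_label {C : ℤ → ℝ} (hC0 : C 0 = 0) (hC : ∀ t : ℤ, C t + 19 / 25 ≤ C (t + 1))
    (t : ℤ) : 19 / 25 * |(t : ℝ)| ≤ |C t| := by
  rcases le_or_gt 0 t with ht | ht
  · have h := lf_gap_iter hC ht
    rw [hC0, Int.cast_zero, sub_zero, zero_add] at h
    rw [abs_of_nonneg (by exact_mod_cast ht : (0 : ℝ) ≤ t)]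
    exact h.trans (le_abs_self _)
  · have h := lf_gap_iter hC ht.le
    rw [hC0, Int.cast_zero, zero_sub] at h
    rw [abs_of_neg (by exact_mod_cast ht : (t : ℝ) < 0)]
    have := neg_abs_le (C t)
    linarith

/-- A level of height `< 19/25 · (m + 1)` in absolute value has index in `[-m, m]`. -/
theorem lf_label_bound {C : ℤ → ℝ} (hC0 : C 0 = 0) (hC : ∀ t : ℤ, C t + 19 / 25 ≤ C (t + 1))
    {t : ℤ} {m : ℕ} (h : |C t| < 19 / 25 * ((m : ℝ) + 1)) : -(m : ℤ) ≤ t ∧ t ≤ m := by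
  have h1 := lf_abs_label hC0 hC t
  have h2 : |(t : ℝ)| < (m : ℝ) + 1 := by nlinarith
  have h3 : |t| < (m : ℤ) + 1 := by
    have : ((|t| : ℤ) : ℝ) < (m : ℝ) + 1 := by rw [Int.cast_abs]; exact h2
    exact_mod_cast this
  have h4 := abs_lt.1 h3
  constructor <;> omega

/-- A level of height `≤ 56/25` in absolute value has index in `[-2, 2]`. -/
theorem lf_label_le_two {C : ℤ → ℝ} (hC0 : C 0 = 0) (hC : ∀ t : ℤ, C t + 19 / 25 ≤ C (t + 1))
    {t : ℤ} (h : |C t| ≤ 56 / 25) : -2 ≤ t ∧ t ≤ 2 := by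
  obtain ⟨h1, h2⟩ := lf_label_bound hC0 hC (t := t) (m := 2) (by push_cast; linarith)
  constructor <;> omega

/-- A level of height `≤ 37/25` in absolute value has index in `[-1, 1]`. -/
theorem lf_label_le_one {C : ℤ → ℝ} (hC0 : C 0 = 0) (hC : ∀ t : ℤ, C t + 19 / 25 ≤ C (t + 1))
    {t : ℤ} (h : |C t| ≤ 37 / 25) : -1 ≤ t ∧ t ≤ 1 := by
  obtain ⟨h1, h2⟩ := lf_label_bound hC0 hC (t := t) (m := 1) (by push_cast; linarith)
  constructor <;> omega

/-- Gapped level heights are strictly increasing (hence injective). -/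
theorem lf_level_strictMono :
    ∀ {C : ℤ → ℝ}, (∀ t : ℤ, C t + 19 / 25 ≤ C (t + 1)) → StrictMono C := by
  intro C hC
  exact strictMono_int_of_lt_succ fun t => by linarith [hC t]

/-- Clamping a gapped level function to the boxes `[t - 3, t + 3]` keeps the gaps `≥ 19/25`
(the boxes themselves move up by `1 ≥ 19/25` per level, and clamping is monotone). -/
theorem lf_clamp_gap {f : ℤ → ℝ} (hf : ∀ t : ℤ, f t + 19 / 25 ≤ f (t + 1)) (t : ℤ) :
    max ((t : ℝ) - 3) (min (f t) ((t : ℝ) + 3)) + 19 / 25 ≤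
      max (((t + 1 : ℤ) : ℝ) - 3) (min (f (t + 1)) (((t + 1 : ℤ) : ℝ) + 3)) := by
  rw [← max_add_add_right, ← min_add_add_right]
  push_cast
  exact max_le_max (by linarith) (min_le_min (hf t) (by linarith))

/-! ## Approximants: distances and heights -/

/-- Distances of `δ`-approximants differ from the distance by at most `2δ`. -/
theorem lf_dist_transfer {u u' x x' : EuclideanSpace ℝ (Fin 3)} {δ : ℝ} (hu : dist u x ≤ δ)
    (hu' : dist u' x' ≤ δ) : |dist u u' - dist x x'| ≤ 2 * δ := by
  have h := dist_dist_dist_le u u' x x'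
  rw [Real.dist_eq] at h
  linarith

/-- Heights of `δ`-approximants along an `ε`-approximate unit normal differ from the height by
at most `2δ + ‖x - x₀‖ ε`. -/
theorem lf_inner_transfer {u u₀ x x₀ n nl : EuclideanSpace ℝ (Fin 3)} {δ ε : ℝ} (hn : ‖n‖ = 1)
    (hu : dist u x ≤ δ) (hu₀ : dist u₀ x₀ ≤ δ) (hnn : ‖n - nl‖ ≤ ε) :
    |inner ℝ (u - u₀) n - inner ℝ (x - x₀) nl| ≤ 2 * δ + ‖x - x₀‖ * ε := by
  have hid : inner ℝ (u - u₀) n - inner ℝ (x - x₀) nl =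
      inner ℝ (u - x - (u₀ - x₀)) n + inner ℝ (x - x₀) (n - nl) := by
    simp only [inner_sub_left, inner_sub_right]
    ring
  rw [hid]
  refine (abs_add_le _ _).trans (add_le_add ?_ ?_)
  · calc |inner ℝ (u - x - (u₀ - x₀)) n| ≤ ‖u - x - (u₀ - x₀)‖ * ‖n‖ :=
          abs_real_inner_le_norm _ _
      _ ≤ (‖u - x‖ + ‖u₀ - x₀‖) * ‖n‖ := by
          rw [hn, mul_one, mul_one]; exact norm_sub_le _ _
      _ ≤ (δ + δ) * 1 := by
          rw [hn, ← dist_eq_norm, ← dist_eq_norm, mul_one, mul_one]; exact add_le_add hu hu₀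
      _ = 2 * δ := by ring
  · calc |inner ℝ (x - x₀) (n - nl)| ≤ ‖x - x₀‖ * ‖n - nl‖ := abs_real_inner_le_norm _ _
      _ ≤ ‖x - x₀‖ * ε := mul_le_mul_of_nonneg_left hnn (norm_nonneg _)

/-! ## Normalising a GOOD window -/

/-- **Normalisation of a GOOD(2, 1, η) window.** A window about `jc` with its own lengths
`a, b ∈ [19/20, 1]`, unit normal `n`, gapped levels `c` and labels `l` (`η`-flat on the `2`-ball,
`19/20`-separated there, exact `6 + 3 + 3` counts with `η`-sharp bonds on the `1`-ball) is
re-labelled by `L j = l j - l jc` with levels `C t = clamp (c (t + l jc) - c (l jc))` to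
`[t - 3, t + 3]`: then `C 0 = 0`, `L jc = 0`, the gaps survive, the clamping is invisible at every
label used in the `2`-ball, and all clauses hold with any tolerance `δ ≥ 2η` (`η ≤ 1/10`). -/
theorem lf_normalise {N : ℕ} {y : Fin N → EuclideanSpace ℝ (Fin 3)} {jc : Fin N} {η δ : ℝ}
    (hη : η ≤ 1 / 10) (hηδ : 2 * η ≤ δ)
    (hgood : ∃ a b : ℝ, 19 / 20 ≤ a ∧ a ≤ 1 ∧ 19 / 20 ≤ b ∧ b ≤ 1 ∧
      ∃ n : EuclideanSpace ℝ (Fin 3), ‖n‖ = 1 ∧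
      ∃ c : ℤ → ℝ, (∀ k : ℤ, c k + 19 / 25 ≤ c (k + 1)) ∧ ∃ l : Fin N → ℤ,
      (∀ j : Fin N, dist (y j) (y jc) ≤ 2 → |inner ℝ (y j - y jc) n - c (l j)| ≤ η) ∧
      (∀ j k : Fin N, dist (y j) (y jc) ≤ 2 → dist (y k) (y jc) ≤ 2 → j ≠ k →
        19 / 20 ≤ dist (y j) (y k)) ∧
      ∀ j : Fin N, dist (y j) (y jc) ≤ 1 →
        Nat.card {k : Fin N // k ≠ j ∧ l k = l j ∧ dist (y j) (y k) ≤ 1} = 6 ∧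
        Nat.card {k : Fin N // l k = l j + 1 ∧ dist (y j) (y k) ≤ 1} = 3 ∧
        Nat.card {k : Fin N // l k = l j - 1 ∧ dist (y j) (y k) ≤ 1} = 3 ∧
        ∀ k : Fin N, k ≠ j → dist (y j) (y k) ≤ 1 →
          (l k = l j → |dist (y j) (y k) - a| ≤ η) ∧ (l k ≠ l j → |dist (y j) (y k) - b| ≤ η)) :
    ∃ (a b : ℝ) (n : EuclideanSpace ℝ (Fin 3)) (C : ℤ → ℝ) (L : Fin N → ℤ),
      (19 / 20 ≤ a ∧ a ≤ 1 ∧ 19 / 20 ≤ b ∧ b ≤ 1 ∧ ‖n‖ = 1 ∧ C 0 = 0 ∧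
        (∀ t : ℤ, C t + 19 / 25 ≤ C (t + 1)) ∧ L jc = 0 ∧ 0 ≤ δ ∧
        (∀ j : Fin N, dist (y j) (y jc) ≤ 2 → |inner ℝ (y j - y jc) n - C (L j)| ≤ δ) ∧
        (∀ j j' : Fin N, dist (y j) (y jc) ≤ 2 → dist (y j') (y jc) ≤ 2 → j ≠ j' →
          19 / 20 ≤ dist (y j) (y j')) ∧
        ∀ j : Fin N, dist (y j) (y jc) ≤ 1 →
          Nat.card {k : Fin N // k ≠ j ∧ L k = L j ∧ dist (y j) (y k) ≤ 1} = 6 ∧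
          Nat.card {k : Fin N // L k = L j + 1 ∧ dist (y j) (y k) ≤ 1} = 3 ∧
          Nat.card {k : Fin N // L k = L j - 1 ∧ dist (y j) (y k) ≤ 1} = 3 ∧
          ∀ k : Fin N, k ≠ j → dist (y j) (y k) ≤ 1 →
            (L k = L j → |dist (y j) (y k) - a| ≤ δ) ∧
            (L k ≠ L j → |dist (y j) (y k) - b| ≤ δ)) ∧
      ∀ t : ℤ, (t : ℝ) - 3 ≤ C t ∧ C t ≤ (t : ℝ) + 3 := by
  obtain ⟨a, b, ha1, ha2, hb1, hb2, n, hn, c, hc, l, hflat, hsep, hcnt⟩ := hgood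
  have hc0 : |c (l jc)| ≤ η := by
    have := hflat jc (by rw [dist_self]; norm_num)
    rwa [sub_self, inner_zero_left, zero_sub, abs_neg] at this
  have hη0 : 0 ≤ η := (abs_nonneg _).trans hc0
  obtain ⟨c', hc'⟩ : ∃ c' : ℤ → ℝ, ∀ t, c' t = c (t + l jc) - c (l jc) := ⟨_, fun t => rfl⟩
  have hc'0 : c' 0 = 0 := by rw [hc', zero_add, sub_self]
  have hc'gap : ∀ t : ℤ, c' t + 19 / 25 ≤ c' (t + 1) := fun t => by
    rw [hc', hc', show t + 1 + l jc = t + l jc + 1 by ring]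
    linarith [hc (t + l jc)]
  obtain ⟨L, hL⟩ : ∃ L : Fin N → ℤ, ∀ j, L j = l j - l jc := ⟨_, fun j => rfl⟩
  have hc'L : ∀ j, c' (L j) = c (l j) - c (l jc) := fun j => by rw [hc', hL, sub_add_cancel]
  obtain ⟨C, hC⟩ :
      ∃ C : ℤ → ℝ, ∀ t, C t = max ((t : ℝ) - 3) (min (c' t) ((t : ℝ) + 3)) := ⟨_, fun t => rfl⟩
  have hflat' : ∀ j, dist (y j) (y jc) ≤ 2 → |inner ℝ (y j - y jc) n - c' (L j)| ≤ 2 * η := by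
    intro j hj
    have h1 := abs_le.1 (hflat j hj)
    have h2 := abs_le.1 hc0
    rw [hc'L, abs_le]
    constructor <;> linarith
  -- the clamping is invisible at every label used in the `2`-ball
  have hCeq : ∀ j, dist (y j) (y jc) ≤ 2 → C (L j) = c' (L j) := by
    intro j hj
    have hin : |inner ℝ (y j - y jc) n| ≤ 2 :=
      calc |inner ℝ (y j - y jc) n| ≤ ‖y j - y jc‖ * ‖n‖ := abs_real_inner_le_norm _ _
        _ ≤ 2 := by rw [hn, mul_one, ← dist_eq_norm]; exact hj
    have hb : |c' (L j)| ≤ 56 / 25 := by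
      have h1 := abs_le.1 (hflat' j hj)
      have h2 := abs_le.1 hin
      rw [abs_le]
      constructor <;> linarith
    obtain ⟨hl1, hl2⟩ := lf_label_le_two hc'0 hc'gap hb
    have hmono := (lf_level_strictMono hc'gap).monotone
    have hb' := abs_le.1 hb
    have hl1' : (-2 : ℝ) ≤ (L j : ℝ) := by exact_mod_cast hl1
    have hl2' : (L j : ℝ) ≤ 2 := by exact_mod_cast hl2
    have hlo : (L j : ℝ) - 3 ≤ c' (L j) := by
      rcases le_or_gt 0 (L j) with h | h
      · have h' : c' 0 ≤ c' (L j) := hmono h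
        rw [hc'0] at h'
        linarith
      · have : (L j : ℝ) < 0 := by exact_mod_cast h
        linarith
    have hhi : c' (L j) ≤ (L j : ℝ) + 3 := by
      rcases le_or_gt (L j) 0 with h | h
      · have h' : c' (L j) ≤ c' 0 := hmono h
        rw [hc'0] at h'
        linarith
      · have : (0 : ℝ) < (L j : ℝ) := by exact_mod_cast h
        linarith
    rw [hC, min_eq_left hhi, max_eq_right hlo]
  have hηδ' : η ≤ δ := by linarith
  refine ⟨a, b, n, C, L, ⟨ha1, ha2, hb1, hb2, hn, ?_, fun t => ?_, ?_, by linarith, ?_, hsep, ?_⟩,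
    fun t => ?_⟩
  · rw [hC, hc'0, Int.cast_zero, min_eq_left (by norm_num), max_eq_right (by norm_num)]
  · rw [hC, hC]
    exact lf_clamp_gap hc'gap t
  · rw [hL, sub_self]
  · intro j hj
    rw [hCeq j hj]
    exact (hflat' j hj).trans hηδ
  · intro j hj
    obtain ⟨h6, h3u, h3d, hsh⟩ := hcnt j hj
    refine ⟨?_, ?_, ?_, fun k hk hd => ?_⟩
    · refine Eq.trans (Nat.card_congr (Equiv.subtypeEquivRight fun k => ?_)) h6
      rw [hL k, hL j]
      exact Iff.and Iff.rfl (Iff.and ⟨fun h => by omega, fun h => by omega⟩ Iff.rfl)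
    · refine Eq.trans (Nat.card_congr (Equiv.subtypeEquivRight fun k => ?_)) h3u
      rw [hL k, hL j]
      exact Iff.and ⟨fun h => by omega, fun h => by omega⟩ Iff.rfl
    · refine Eq.trans (Nat.card_congr (Equiv.subtypeEquivRight fun k => ?_)) h3d
      rw [hL k, hL j]
      exact Iff.and ⟨fun h => by omega, fun h => by omega⟩ Iff.rfl
    · rw [hL k, hL j]
      obtain ⟨hs1, hs2⟩ := hsh k hk hd
      exact ⟨fun h => (hs1 (by omega)).trans hηδ', fun h => (hs2 fun h' => h (by omega)).trans hηδ'⟩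
  · rw [hC]
    exact ⟨le_max_left _ _, max_le (by linarith) (min_le_right _ _)⟩

end Summit.AtomisticToContinuum.Crystallization.Theorems.SquareWellLayerCake.StackingFaultSparsity.LocalFrames.Limit

end
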